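import Mathlib
import Summits.Ventures.PercRepro2.Defs
import Summits.Ventures.PercRepro2.Graph
import Summits.Ventures.PercRepro2.HullDefs
import Summits.Ventures.PercRepro2.LocRows
import Summits.Ventures.PercRepro2.SwRow
import Summits.Ventures.PercRepro2.SwAllRow
import Summits.Ventures.PercRepro2.TypedRow

/-!
# The doubly typed rigid row (blind cell PercRepro2, night-4 g7, 2026-08-25; proofs/NIGHT4-G7.md §9)

The typed rigid row `LocRows.TypedSwAll` carries monotone conditions on the two clusters of the root
`l` (an up-set `𝓤` for `C_R(l)`, a down-set `𝓓` for `C_B(l)`).  The 2-cut composition asks for the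
same row with conditions AT THE AVOIDED VERTEX `h` as well: a set `X` of vertices that lie outside
the hull of `h`, and an up-set condition `𝓤′` on the blue cluster of `h`.  `dTypedQ` is the class
`{h ∉ H_l, C_R(l) ∈ 𝓤, C_B(l) ∈ 𝓓, X ∩ H_h = ∅, C_B(h) ∈ 𝓤′}` and `DTypedSwAll` asks for a rigid
permutation of it (every red edge inside `C_R(h)` flipped).  `TypedSwAll` is the case `X = ∅`,
`𝓤′ = univ` (`typed_of_dTyped`).  Census (night-4 g7, dtyped.py): 0 failures on all connected graphs
`n ≤ 5` for all `𝓤`, `𝓓` with ≤ 1 generator, `X` of size ≤ 2 and principal `𝓤′` (n = 5: 0 / 2,480,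
0 / 3,760, 0 / 6,744); a DOWN-set condition on `C_B(h)` alone is false (a vertex of `C_R(h)` is
forced into `C_B(h)` by the flip) — the avoided-vertex conditions must be hull conditions or blue
up-sets.  The side-2 class `(n,n,1,0)` of the 2-cut composition is `DTypedSwAll u h ↑v (↑v)ᶜ {v} univ`.
-/

namespace Summit.Ventures.PercRepro2

namespace LocRows

open Hull

variable {V : Type*} {E : Type*} [Fintype E] [DecidableEq E]

open scoped Classical

variable (ends : E → Sym2 V)

/-- The doubly typed class `{h ∉ H_l, C_R(l) ∈ 𝓤, C_B(l) ∈ 𝓓, X ∩ H_h = ∅, C_B(h) ∈ 𝓤′}`. -/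
noncomputable def dTypedQ (l h : V) (𝓤 𝓓 : Set (Set V)) (X : Set V) (𝓤' : Set (Set V)) :
    Finset (Config E) :=
  Finset.univ.filter fun ζ =>
    h ∉ hull ends ζ l ∧ cluster ends ζ l ∈ 𝓤 ∧ cluster ends (blue ζ) l ∈ 𝓓 ∧
      (∀ x ∈ X, x ∉ hull ends ζ h) ∧ cluster ends (blue ζ) h ∈ 𝓤'

/-- **The doubly typed rigid row**: a rigid permutation of `dTypedQ`. -/
def DTypedSwAll (l h : V) (𝓤 𝓓 : Set (Set V)) (X : Set V) (𝓤' : Set (Set V)) : Prop :=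
  ∃ f : {ζ // ζ ∈ dTypedQ ends l h 𝓤 𝓓 X 𝓤'} → Config E, Function.Injective f ∧
    ∀ x, f x ∈ dTypedQ ends l h 𝓤 𝓓 X 𝓤' ∧
      ∀ e, e ∈ within ends (cluster ends x.1 h) → x.1 e = true → f x e = false

/-- Without avoided-vertex conditions the doubly typed class is the typed class. -/
lemma dTypedQ_empty_univ (l h : V) (𝓤 𝓓 : Set (Set V)) :
    dTypedQ ends l h 𝓤 𝓓 ∅ Set.univ = typedQ ends l h 𝓤 𝓓 := by
  ext ζ
  simp [dTypedQ, typedQ]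

/-- **The doubly typed row without avoided-vertex conditions is the typed row.** -/
theorem typed_of_dTyped {l h : V} {𝓤 𝓓 : Set (Set V)}
    (hD : DTypedSwAll ends l h 𝓤 𝓓 ∅ Set.univ) : TypedSwAll ends l h 𝓤 𝓓 := by
  obtain ⟨f, hf, hmem⟩ := hD
  have e := dTypedQ_empty_univ ends l h 𝓤 𝓓
  have hin : ∀ x : {ζ // ζ ∈ typedQ ends l h 𝓤 𝓓}, x.1 ∈ dTypedQ ends l h 𝓤 𝓓 ∅ Set.univ :=
    fun x => by rw [e]; exact x.2
  have hiff : ∀ ζ, ζ ∈ dTypedQ ends l h 𝓤 𝓓 ∅ Set.univ ↔ ζ ∈ typedQ ends l h 𝓤 𝓓 :=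
    fun ζ => by rw [e]
  refine ⟨fun x => f ⟨x.1, hin x⟩, ?_, fun x => ?_⟩
  · intro x y hxy
    have h1 : (⟨x.1, hin x⟩ : {ζ // ζ ∈ dTypedQ ends l h 𝓤 𝓓 ∅ Set.univ}) = ⟨y.1, hin y⟩ := hf hxy
    exact Subtype.ext (Subtype.mk.inj h1)
  · obtain ⟨h1, h2⟩ := hmem ⟨x.1, hin x⟩
    exact ⟨(hiff _).1 h1, h2⟩

/-- The doubly typed row over all finite graphs, markings and families. -/
def DTypedSwAll_all : Prop :=
  ∀ (V E : Type) [Fintype V] [DecidableEq V] [Fintype E] [DecidableEq E] (ends : E → Sym2 V)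
    (l h : V) (𝓤 𝓓 : Set (Set V)) (X : Set V) (𝓤' : Set (Set V)), IsUpperSet 𝓤 →
      IsLowerSet 𝓓 → IsUpperSet 𝓤' → DTypedSwAll ends l h 𝓤 𝓓 X 𝓤'

/-- `DTypedSwAll_all` gives `TypedSwAll_all`. -/
theorem typed_all_of_dTyped_all (hD : DTypedSwAll_all) : TypedSwAll_all := by
  intro V E _ _ _ _ ends l h 𝓤 𝓓 h𝓤 h𝓓
  exact typed_of_dTyped ends (hD V E ends l h 𝓤 𝓓 ∅ Set.univ h𝓤 h𝓓 isUpperSet_univ)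

/-- `DTypedSwAll_all` gives `SwAll_all`, hence `Sw_all`. -/
theorem swAll_all_of_dTyped_all (hD : DTypedSwAll_all) : SwAll_all :=
  swAll_all_of_typed_all (typed_all_of_dTyped_all hD)

/-- `DTypedSwAll_all` gives `Sw_all`. -/
theorem sw_all_of_dTyped_all (hD : DTypedSwAll_all) : Sw_all :=
  sw_all_of_typed_all (typed_all_of_dTyped_all hD)

end LocRows

end Summit.Ventures.PercRepro2
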